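import Summits.CriticalPhenomena.SAWScalingLimit.Theorems.SAWTotalPositivityBoundaryTP2Defs
import Summits.CriticalPhenomena.SAWScalingLimit.Theorems.SAWTotalPositivityBoundaryTP2Kernel
import Summits.CriticalPhenomena.SAWScalingLimit.Theorems.SAWTotalPositivityBoundaryTP2Symmetry
import Summits.CriticalPhenomena.SAWScalingLimit.Theorems.SAWTotalPositivityBoundaryTP2LadderRung
import Summits.CriticalPhenomena.SAWScalingLimit.Theorems.SAWTotalPositivityBoundaryTP2LadderKernelsInterior
import Summits.CriticalPhenomena.SAWScalingLimit.Theorems.EdgeOfPositivity.Negative.EdgeOfPositivityRectDomain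
import HarnessLib

/-!
# Crux `BoundaryTP2` (stmt-CriticalPhenomena-7115), line `Sketch`: the tie `d₂ = c₁` of the
bottom-bottom-top-top quadruples on a ladder, crossing pairing vs nested pairing

Tool stub `stub_ladder_bbtt_nested7` of the line's skeleton: on the ladder
`R_L = discreteDomainGraph (rectDomain L 1) 1` (sites `{0..L} × {0,1}`), for columns
`c₁ < c₂ < d₁ ≤ L` and every fugacity `0 ≤ x ≤ 1/2`, the four sites `(c₁,0), (c₂,0), (d₁,1), (c₁,1)`
(in cyclic order; `(c₁,1)` sits above `(c₁,0)`) satisfy crossing ≤ nested: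

  `Z((c₁,0),(d₁,1)) · Z((c₂,0),(c₁,1)) ≤ Z((c₁,0),(c₁,1)) · Z((c₂,0),(d₁,1))`,  `Z = pathKernel R_L x`.

Proof. Write `P = 1+x`, `M = 1-x`, `E_k = Σ_{d<k} x^{2d+3}`, `a_c = P + E_c`, `a'_c = M - E_c`,
`b_j = P + E_{L-j}`, `b'_j = M - E_{L-j}`. By the landed two-point kernels of the ladder
(`stub_ladderKernels_interior`, sign `ε = -1` for end points on different rows) every kernel between
sites on opposite rows in columns `i < j`, `n + 1 = j - i`, has the rank-two form

  `Z((i,r),(j,s)) = x^{n+1}/2 · (a_i b_j P^n - a'_i b'_j M^n)`     (`nested7_kernel`),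

and the rung is `Z((c,0),(c,1)) = x + E_c + E_{L-c}` (`stub_ladderRung`). On `[0, 1/2]`,
`0 ≤ E_k ≤ 1/6`, `E_k` is monotone in `k`, `a' P ≤ a M`, `b' P ≤ b M`, `M ≤ P`.

*Key monotonicity* (`nested7_chain`). If `U, V ≥ 0` and `V P² ≤ U M²` then
`x^k (P^k U - M^k V) ≤ U - V` for every `k`: the one-step version `x (P U - M V) ≤ U - V`
(`nested7_step`) is `V (1 - xM) ≤ U (1 - xP)`, which follows from `V ≤ U M²/P²` and the polynomial
inequality `M² (1 - xM) ≤ P² (1 - xP)`, i.e. `0 ≤ 2x (2 - 3x - x³)`, on `[0, 1/2]`; the hypothesis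
`V P² ≤ U M²` is inherited by `(P^k U, M^k V)`. The base hypothesis `a' b' M^k P² ≤ a b P^k M²` is
`nested7_base`.

* (i) `Z((c₂,0),(c₁,1)) = Z((c₁,1),(c₂,0)) = x/2 · x^u (P^u a_{c₁} b_{c₂} - M^u a'_{c₁} b'_{c₂})`
  `≤ x/2 · (a_{c₁} b_{c₂} - a'_{c₁} b'_{c₂}) = 2x² + x (E_{c₁} + E_{L-c₂}) ≤ x + E_{c₁} + E_{L-c₂}`,
  which is at most the rung `x + E_{c₁} + E_{L-c₁}` (`nested7_cross_le`, `E` monotone).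
* (ii) `Z((c₁,0),(d₁,1)) ≤ Z((c₂,0),(d₁,1))` (`nested7_far_mono`): replacing `a_{c₁} ≤ a_{c₂}`,
  `a'_{c₁} ≥ a'_{c₂}` and then applying the key monotonicity with `k = c₂ - c₁`,
  `U = a_{c₂} b_{d₁} P^{w}`, `V = a'_{c₂} b'_{d₁} M^{w}` (`w + 1 = d₁ - c₂`).
The product of (i) and (ii) is the claim; the assembly in `ℝ≥0∞` is
`ENNReal.ofReal_mul` / `ENNReal.ofReal_le_ofReal`.
-/

noncomputable section

namespace Summit.CriticalPhenomena.SAWScalingLimit.Theorems.BoundaryTP2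

open Literature.Probability.LatticeModels Literature.Probability.RandomPlanarGeometry
open Summit.CriticalPhenomena.SAWScalingLimit.Theorems.EdgeOfPositivity.Negative
open scoped ENNReal

/-! ## The excursion sums `E_k = Σ_{d<k} x^{2d+3}` -/

-- adapted from `…BoundaryTP2LadderBottomRowAdjacent` (`ladderAdj_E_*`)

/-- `E_k ≥ 0` for `x ≥ 0`. [folklore] -/
private theorem nested7_E_nonneg {x : ℝ} (hx : 0 ≤ x) (k : ℕ) :
    0 ≤ ∑ d ∈ Finset.range k, x ^ (2 * d + 3) :=
  Finset.sum_nonneg fun _ _ => pow_nonneg hx _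

/-- Telescoping: `E_k (1 - x²) + x^{2k+3} = x³`. [folklore] -/
private theorem nested7_E_telescope (x : ℝ) (k : ℕ) :
    (∑ d ∈ Finset.range k, x ^ (2 * d + 3)) * (1 - x ^ 2) + x ^ (2 * k + 3) = x ^ 3 := by
  induction k with
  | zero => simp
  | succ k ih =>
    rw [Finset.sum_range_succ]
    linear_combination ih

/-- `E_k ≤ 1/6` for `0 ≤ x ≤ 1/2` (from `E_k (1 - x²) ≤ x³ ≤ 1/8` and `1 - x² ≥ 3/4`).
[folklore] -/
private theorem nested7_E_le {x : ℝ} (hx0 : 0 ≤ x) (hx : x ≤ 1 / 2) (k : ℕ) :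
    ∑ d ∈ Finset.range k, x ^ (2 * d + 3) ≤ 1 / 6 := by
  have h := nested7_E_telescope x k
  have hE := nested7_E_nonneg hx0 k
  have hk : 0 ≤ x ^ (2 * k + 3) := pow_nonneg hx0 _
  have hx2 : x ^ 2 ≤ (1 / 2) ^ 2 := pow_le_pow_left₀ hx0 hx 2
  have hx3 : x ^ 3 ≤ (1 / 2) ^ 3 := pow_le_pow_left₀ hx0 hx 3
  norm_num at hx2 hx3
  nlinarith [mul_nonneg hE (by linarith : (0 : ℝ) ≤ 1 / 4 - x ^ 2)]

/-- `E_k` is monotone in `k` for `x ≥ 0`. [folklore] -/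
private theorem nested7_E_mono {x : ℝ} (hx : 0 ≤ x) {k l : ℕ} (hkl : k ≤ l) :
    ∑ d ∈ Finset.range k, x ^ (2 * d + 3) ≤ ∑ d ∈ Finset.range l, x ^ (2 * d + 3) :=
  Finset.sum_le_sum_of_subset_of_nonneg (Finset.range_mono hkl) fun _ _ _ => pow_nonneg hx _

/-! ## The rank-two form of the ladder kernels between opposite rows -/

/-- Opposite-row kernels of the ladder `{0..L}×{0,1}` in rank-two form: for `i + n + 1 = j ≤ L`,
`x ≥ 0` and rows `r ≠ s` in `{0,1}`,
`Z_{R_L}((i,r),(j,s)) = x^{n+1}/2 · (a_i b_j (1+x)^n - a'_i b'_j (1-x)^n)` with `a_i = 1+x+E_i`,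
`a'_i = 1-x-E_i`, `b_j = 1+x+E_{L-j}`, `b'_j = 1-x-E_{L-j}` (a regrouping of
`stub_ladderKernels_interior` with the sign `ε = -1`). [folklore] -/
private theorem nested7_kernel (L i j n : ℕ) (hn : i + n + 1 = j) (hjL : j ≤ L) {x : ℝ} (hx : 0 ≤ x)
    (r s : ℤ) (hr : r = 0 ∨ r = 1) (hs : s = 0 ∨ s = 1) (hrs : r ≠ s) :
    pathKernel (discreteDomainGraph (rectDomain L 1) 1) x (st i r) (st j s) =
      ENNReal.ofReal (x ^ (n + 1) / 2 *
        ((1 + x + ∑ d ∈ Finset.range i, x ^ (2 * d + 3)) *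
              (1 + x + ∑ d ∈ Finset.range (L - j), x ^ (2 * d + 3)) * (1 + x) ^ n -
          (1 - x - ∑ d ∈ Finset.range i, x ^ (2 * d + 3)) *
              (1 - x - ∑ d ∈ Finset.range (L - j), x ^ (2 * d + 3)) * (1 - x) ^ n)) := by
  -- adapted from `ladderBbbt_kernel_mixed` in `…BoundaryTP2LadderBbbtAdjacent`
  rw [stub_ladderKernels_interior L i j (by omega) hjL hx r s hr hs, if_neg hrs]
  congr 1
  subst hn
  have e1 : i + n + 1 - i = n + 1 := by omega
  have e2 : n + 1 - 1 = n := rfl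
  rw [e1, e2]
  ring

/-! ## The key monotonicity in the span -/

/-- One step: `x (P U - M V) ≤ U - V` for `U ≥ 0`, `V P² ≤ U M²`, `0 ≤ x ≤ 1/2` (`P = 1+x`,
`M = 1-x`). Multiplying by `P²`, it reads `V P² (1 - xM) ≤ U P² (1 - xP)`, and
`V P² (1 - xM) ≤ U M² (1 - xM) ≤ U P² (1 - xP)` since `P² (1 - xP) - M² (1 - xM) = 2x (2 - 3x - x³) ≥ 0`.
[folklore] -/
private theorem nested7_step {x U V : ℝ} (hx0 : 0 ≤ x) (hx : x ≤ 1 / 2) (hU : 0 ≤ U)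
    (hVU : V * (1 + x) ^ 2 ≤ U * (1 - x) ^ 2) :
    x * ((1 + x) * U - (1 - x) * V) ≤ U - V := by
  have hP2 : 0 < (1 + x) ^ 2 := by positivity
  have h1 : 0 ≤ 1 - x * (1 - x) := by nlinarith
  have h2 : 0 ≤ U * (2 * x * (2 - 3 * x - x ^ 3)) := by
    refine mul_nonneg hU (mul_nonneg (by positivity) ?_)
    have hx3 : x ^ 3 ≤ (1 / 2) ^ 3 := pow_le_pow_left₀ hx0 hx 3
    norm_num at hx3
    linarith
  have h3 := mul_le_mul_of_nonneg_right hVU h1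
  refine le_of_mul_le_mul_right ?_ hP2
  have key : (U - V) * (1 + x) ^ 2 - x * ((1 + x) * U - (1 - x) * V) * (1 + x) ^ 2 =
      U * (2 * x * (2 - 3 * x - x ^ 3)) +
        (U * (1 - x) ^ 2 * (1 - x * (1 - x)) - V * (1 + x) ^ 2 * (1 - x * (1 - x))) := by ring
  nlinarith [key, h2, h3]

/-- The key monotonicity: `x^k (P^k U - M^k V) ≤ U - V` for all `k`, for `U, V ≥ 0` with
`V P² ≤ U M²` and `0 ≤ x ≤ 1/2` (induction: the hypothesis passes to `(P^k U, M^k V)` because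
`M^k ≤ P^k`, then `nested7_step`). [folklore] -/
private theorem nested7_chain {x U V : ℝ} (hx0 : 0 ≤ x) (hx : x ≤ 1 / 2) (hU : 0 ≤ U) (hV : 0 ≤ V)
    (hVU : V * (1 + x) ^ 2 ≤ U * (1 - x) ^ 2) (k : ℕ) :
    x ^ k * ((1 + x) ^ k * U - (1 - x) ^ k * V) ≤ U - V := by
  induction k with
  | zero => simp
  | succ k ih =>
    have hMP : (1 - x) ^ k ≤ (1 + x) ^ k := pow_le_pow_left₀ (by linarith) (by linarith) k
    have hPk : 0 ≤ (1 + x) ^ k := pow_nonneg (by linarith) k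
    have h' : (1 - x) ^ k * V * (1 + x) ^ 2 ≤ (1 + x) ^ k * U * (1 - x) ^ 2 :=
      calc (1 - x) ^ k * V * (1 + x) ^ 2 = (1 - x) ^ k * (V * (1 + x) ^ 2) := by ring
        _ ≤ (1 + x) ^ k * (U * (1 - x) ^ 2) :=
            mul_le_mul hMP hVU (mul_nonneg hV (by positivity)) hPk
        _ = (1 + x) ^ k * U * (1 - x) ^ 2 := by ring
    have hs := nested7_step hx0 hx (mul_nonneg hPk hU) h'
    calc x ^ (k + 1) * ((1 + x) ^ (k + 1) * U - (1 - x) ^ (k + 1) * V)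
        = x ^ k * (x * ((1 + x) * ((1 + x) ^ k * U) - (1 - x) * ((1 - x) ^ k * V))) := by ring
      _ ≤ x ^ k * ((1 + x) ^ k * U - (1 - x) ^ k * V) :=
          mul_le_mul_of_nonneg_left hs (pow_nonneg hx0 k)
      _ ≤ U - V := ih

/-- The base hypothesis of the key monotonicity for the rank-two brackets:
`a' b' M^k P² ≤ a b P^k M²`, from `a' P ≤ a M`, `b' P ≤ b M`, `M^k ≤ P^k` (`0 ≤ x ≤ 1/2`,
`e ≥ 0`, `0 ≤ f ≤ 1/6`). [folklore] -/
private theorem nested7_base {x e f : ℝ} (k : ℕ) (hx0 : 0 ≤ x) (hx : x ≤ 1 / 2) (he0 : 0 ≤ e)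
    (hf0 : 0 ≤ f) (hf : f ≤ 1 / 6) :
    (1 - x - e) * (1 - x - f) * (1 - x) ^ k * (1 + x) ^ 2 ≤
      (1 + x + e) * (1 + x + f) * (1 + x) ^ k * (1 - x) ^ 2 := by
  -- adapted from `ladderBbbt_diff_lower` in `…BoundaryTP2LadderBbbtAdjacent`
  have h1 : (1 - x - e) * (1 + x) ≤ (1 + x + e) * (1 - x) := by nlinarith
  have h2 : (1 - x - f) * (1 + x) ≤ (1 + x + f) * (1 - x) := by nlinarith
  have h3 : (1 - x) ^ k ≤ (1 + x) ^ k := pow_le_pow_left₀ (by linarith) (by linarith) k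
  have key : (1 - x - e) * (1 + x) * ((1 - x - f) * (1 + x)) * (1 - x) ^ k ≤
      (1 + x + e) * (1 - x) * ((1 + x + f) * (1 - x)) * (1 + x) ^ k :=
    mul_le_mul (mul_le_mul h1 h2 (mul_nonneg (by linarith) (by linarith))
      (mul_nonneg (by linarith) (by linarith))) h3 (pow_nonneg (by linarith) k)
      (mul_nonneg (mul_nonneg (by linarith) (by linarith)) (mul_nonneg (by linarith) (by linarith)))
  calc (1 - x - e) * (1 - x - f) * (1 - x) ^ k * (1 + x) ^ 2
      = (1 - x - e) * (1 + x) * ((1 - x - f) * (1 + x)) * (1 - x) ^ k := by ring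
    _ ≤ (1 + x + e) * (1 - x) * ((1 + x + f) * (1 - x)) * (1 + x) ^ k := key
    _ = (1 + x + e) * (1 + x + f) * (1 + x) ^ k * (1 - x) ^ 2 := by ring

/-! ## Real inequalities in the rank-two variables -/

/-- The rank-two form of an opposite-row kernel is nonnegative: `a' b' M^k ≤ a b P^k` termwise
(`a' ≤ a`, `0 ≤ b' ≤ b`, `0 ≤ M ≤ P`). [folklore] -/
private theorem nested7_form_nonneg {x e f : ℝ} (k : ℕ) (hx0 : 0 ≤ x) (hx : x ≤ 1 / 2)
    (he0 : 0 ≤ e) (hf0 : 0 ≤ f) (hf : f ≤ 1 / 6) :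
    0 ≤ x ^ (k + 1) / 2 *
      ((1 + x + e) * (1 + x + f) * (1 + x) ^ k - (1 - x - e) * (1 - x - f) * (1 - x) ^ k) :=
  -- adapted from `ladderBbbt_diff_nonneg` in `…BoundaryTP2LadderBbbtAdjacent`
  mul_nonneg (by positivity) (sub_nonneg.2
    (mul_le_mul (mul_le_mul (by linarith) (by linarith) (by linarith) (by linarith))
      (pow_le_pow_left₀ (by linarith) (by linarith) k) (pow_nonneg (by linarith) k)
      (mul_nonneg (by linarith) (by linarith))))

/-- **(i)** The cross kernel between two columns is at most `x + e + f`
(`e = E_i`, `f = E_{L-j}`): by the key monotonicity with `U = a b`, `V = a' b'`,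
`x^{u+1}/2 (a b P^u - a' b' M^u) ≤ x/2 (a b - a' b') = 2x² + x (e + f) ≤ x + e + f` (`2x ≤ 1`).
[folklore] -/
private theorem nested7_cross_le {x e f : ℝ} (u : ℕ) (hx0 : 0 ≤ x) (hx : x ≤ 1 / 2) (he0 : 0 ≤ e)
    (he : e ≤ 1 / 6) (hf0 : 0 ≤ f) (hf : f ≤ 1 / 6) :
    x ^ (u + 1) / 2 *
        ((1 + x + e) * (1 + x + f) * (1 + x) ^ u - (1 - x - e) * (1 - x - f) * (1 - x) ^ u) ≤
      x + e + f := by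
  have hU : 0 ≤ (1 + x + e) * (1 + x + f) := mul_nonneg (by linarith) (by linarith)
  have hV : 0 ≤ (1 - x - e) * (1 - x - f) := mul_nonneg (by linarith) (by linarith)
  have hVU : (1 - x - e) * (1 - x - f) * (1 + x) ^ 2 ≤ (1 + x + e) * (1 + x + f) * (1 - x) ^ 2 := by
    simpa using nested7_base 0 hx0 hx he0 hf0 hf
  calc x ^ (u + 1) / 2 *
        ((1 + x + e) * (1 + x + f) * (1 + x) ^ u - (1 - x - e) * (1 - x - f) * (1 - x) ^ u)
      = x / 2 * (x ^ u * ((1 + x) ^ u * ((1 + x + e) * (1 + x + f)) -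
          (1 - x) ^ u * ((1 - x - e) * (1 - x - f)))) := by ring
    _ ≤ x / 2 * ((1 + x + e) * (1 + x + f) - (1 - x - e) * (1 - x - f)) :=
        mul_le_mul_of_nonneg_left (nested7_chain hx0 hx hU hV hVU u) (by positivity)
    _ = 2 * x ^ 2 + x * (e + f) := by ring
    _ ≤ x + e + f := by
        nlinarith [mul_nonneg hx0 (by linarith : (0 : ℝ) ≤ 1 - 2 * x),
          mul_nonneg (add_nonneg he0 hf0) (by linarith : (0 : ℝ) ≤ 1 - x)]

/-- **(ii)** The cross kernel to the far top site `(d₁,1)` does not decrease as the bottom site moves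
closer: with `e₁ = E_{c₁} ≤ e₂ = E_{c₂}`, `g = E_{L-d₁}`, spans `c₂ - c₁ = u+1`, `d₁ - c₂ = w+1`,
`x^{u+w+2}/2 (a₁ b P^{u+w+1} - a'₁ b' M^{u+w+1}) ≤ x^{w+1}/2 (a₂ b P^w - a'₂ b' M^w)`: first
`a₁ ≤ a₂`, `a'₂ ≤ a'₁`, then the key monotonicity with `k = u+1`, `U = a₂ b P^w`, `V = a'₂ b' M^w`.
[folklore] -/
private theorem nested7_far_mono {x e₁ e₂ g : ℝ} (u w : ℕ) (hx0 : 0 ≤ x) (hx : x ≤ 1 / 2)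
    (he₁ : 0 ≤ e₁) (he₂ : e₂ ≤ 1 / 6) (h₁₂ : e₁ ≤ e₂) (hg0 : 0 ≤ g) (hg : g ≤ 1 / 6) :
    x ^ (u + w + 1 + 1) / 2 *
        ((1 + x + e₁) * (1 + x + g) * (1 + x) ^ (u + w + 1) -
          (1 - x - e₁) * (1 - x - g) * (1 - x) ^ (u + w + 1)) ≤
      x ^ (w + 1) / 2 *
        ((1 + x + e₂) * (1 + x + g) * (1 + x) ^ w - (1 - x - e₂) * (1 - x - g) * (1 - x) ^ w) := by
  have hb : 0 ≤ 1 + x + g := by linarith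
  have hb' : 0 ≤ 1 - x - g := by linarith
  have hPk : 0 ≤ (1 + x) ^ (u + w + 1) := pow_nonneg (by linarith) _
  have hMk : 0 ≤ (1 - x) ^ (u + w + 1) := pow_nonneg (by linarith) _
  have s1 : (1 + x + e₁) * (1 + x + g) * (1 + x) ^ (u + w + 1) ≤
      (1 + x + e₂) * (1 + x + g) * (1 + x) ^ (u + w + 1) :=
    mul_le_mul_of_nonneg_right (mul_le_mul_of_nonneg_right (by linarith) hb) hPk
  have s2 : (1 - x - e₂) * (1 - x - g) * (1 - x) ^ (u + w + 1) ≤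
      (1 - x - e₁) * (1 - x - g) * (1 - x) ^ (u + w + 1) :=
    mul_le_mul_of_nonneg_right (mul_le_mul_of_nonneg_right (by linarith) hb') hMk
  have hU : 0 ≤ (1 + x + e₂) * (1 + x + g) * (1 + x) ^ w :=
    mul_nonneg (mul_nonneg (by linarith) hb) (pow_nonneg (by linarith) w)
  have hV : 0 ≤ (1 - x - e₂) * (1 - x - g) * (1 - x) ^ w :=
    mul_nonneg (mul_nonneg (by linarith) hb') (pow_nonneg (by linarith) w)
  have hc := nested7_chain hx0 hx hU hV (nested7_base w hx0 hx (he₁.trans h₁₂) hg0 hg) (u + 1)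
  calc x ^ (u + w + 1 + 1) / 2 *
        ((1 + x + e₁) * (1 + x + g) * (1 + x) ^ (u + w + 1) -
          (1 - x - e₁) * (1 - x - g) * (1 - x) ^ (u + w + 1))
      ≤ x ^ (u + w + 1 + 1) / 2 *
        ((1 + x + e₂) * (1 + x + g) * (1 + x) ^ (u + w + 1) -
          (1 - x - e₂) * (1 - x - g) * (1 - x) ^ (u + w + 1)) :=
        mul_le_mul_of_nonneg_left (sub_le_sub s1 s2) (by positivity)
    _ = x ^ (w + 1) / 2 * (x ^ (u + 1) *
        ((1 + x) ^ (u + 1) * ((1 + x + e₂) * (1 + x + g) * (1 + x) ^ w) -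
          (1 - x) ^ (u + 1) * ((1 - x - e₂) * (1 - x - g) * (1 - x) ^ w))) := by ring
    _ ≤ x ^ (w + 1) / 2 *
        ((1 + x + e₂) * (1 + x + g) * (1 + x) ^ w - (1 - x - e₂) * (1 - x - g) * (1 - x) ^ w) :=
        mul_le_mul_of_nonneg_left hc (by positivity)

/-! ## The stub -/

/-- **Tool stub `stub_ladder_bbtt_nested7`.** On the ladder `{0..L}×{0,1}`, for columns
`c₁ < c₂ < d₁ ≤ L` and `0 ≤ x ≤ 1/2`, the quadruple `(c₁,0), (c₂,0), (d₁,1), (c₁,1)` (cyclic order)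
satisfies crossing ≤ nested:
`Z((c₁,0),(d₁,1)) · Z((c₂,0),(c₁,1)) ≤ Z((c₁,0),(c₁,1)) · Z((c₂,0),(d₁,1))`. Mechanism: in the
rank-two form of the opposite-row kernels (`nested7_kernel`), (i) the cross kernel between the
columns `c₁ < c₂` is at most `x + E_{c₁} + E_{L-c₂} ≤ rung(c₁)` (`nested7_cross_le`), and (ii) the
cross kernel into `(d₁,1)` grows as the bottom site approaches (`nested7_far_mono`); both rest on the
monotonicity `x^k (P^k U - M^k V) ≤ U - V` for `V P² ≤ U M²` on `[0, 1/2]` (`nested7_chain`).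
[folklore] -/
theorem stub_ladder_bbtt_nested7 (L : ℕ) {c₁ c₂ d₁ : ℕ} (h₁ : c₁ < c₂) (h₂ : c₂ < d₁) (h₃ : d₁ ≤ L)
    {x : ℝ} (hx0 : 0 ≤ x) (hx : x ≤ 1 / 2) :
    pathKernel (discreteDomainGraph (rectDomain L 1) 1) x (st c₁ 0) (st d₁ 1) *
        pathKernel (discreteDomainGraph (rectDomain L 1) 1) x (st c₂ 0) (st c₁ 1) ≤
      pathKernel (discreteDomainGraph (rectDomain L 1) 1) x (st c₁ 0) (st c₁ 1) *
        pathKernel (discreteDomainGraph (rectDomain L 1) 1) x (st c₂ 0) (st d₁ 1) := by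
  obtain ⟨u, hu⟩ : ∃ u, c₂ = c₁ + u + 1 := ⟨c₂ - c₁ - 1, by omega⟩
  obtain ⟨w, hw⟩ : ∃ w, d₁ = c₂ + w + 1 := ⟨d₁ - c₂ - 1, by omega⟩
  have hE := fun k => nested7_E_nonneg hx0 k
  have hE' := fun k => nested7_E_le hx0 hx k
  rw [pathKernel_comm _ x (st c₂ 0) (st c₁ 1),
    nested7_kernel L c₁ d₁ (u + w + 1) (by omega) h₃ hx0 0 1 (Or.inl rfl) (Or.inr rfl) (by norm_num),
    nested7_kernel L c₁ c₂ u (by omega) (by omega) hx0 1 0 (Or.inr rfl) (Or.inl rfl) (by norm_num),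
    stub_ladderRung L c₁ (by omega) hx0,
    nested7_kernel L c₂ d₁ w (by omega) h₃ hx0 0 1 (Or.inl rfl) (Or.inr rfl) (by norm_num),
    ← ENNReal.ofReal_mul
      (nested7_form_nonneg (u + w + 1) hx0 hx (hE c₁) (hE (L - d₁)) (hE' (L - d₁))),
    ← ENNReal.ofReal_mul (add_nonneg (add_nonneg hx0 (hE c₁)) (hE (L - c₁)))]
  refine ENNReal.ofReal_le_ofReal ?_
  have hi : x ^ (u + 1) / 2 *
        ((1 + x + ∑ d ∈ Finset.range c₁, x ^ (2 * d + 3)) *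
              (1 + x + ∑ d ∈ Finset.range (L - c₂), x ^ (2 * d + 3)) * (1 + x) ^ u -
          (1 - x - ∑ d ∈ Finset.range c₁, x ^ (2 * d + 3)) *
              (1 - x - ∑ d ∈ Finset.range (L - c₂), x ^ (2 * d + 3)) * (1 - x) ^ u) ≤
      x + (∑ d ∈ Finset.range c₁, x ^ (2 * d + 3)) + ∑ d ∈ Finset.range (L - c₁), x ^ (2 * d + 3) :=
    (nested7_cross_le u hx0 hx (hE c₁) (hE' c₁) (hE (L - c₂)) (hE' (L - c₂))).trans
      (by linarith [nested7_E_mono hx0 (by omega : L - c₂ ≤ L - c₁)])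
  have hii := nested7_far_mono u w hx0 hx (hE c₁) (hE' c₂)
    (nested7_E_mono hx0 (by omega : c₁ ≤ c₂)) (hE (L - d₁)) (hE' (L - d₁))
  calc _ ≤ x ^ (w + 1) / 2 *
          ((1 + x + ∑ d ∈ Finset.range c₂, x ^ (2 * d + 3)) *
                (1 + x + ∑ d ∈ Finset.range (L - d₁), x ^ (2 * d + 3)) * (1 + x) ^ w -
            (1 - x - ∑ d ∈ Finset.range c₂, x ^ (2 * d + 3)) *
                (1 - x - ∑ d ∈ Finset.range (L - d₁), x ^ (2 * d + 3)) * (1 - x) ^ w) *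
        (x + (∑ d ∈ Finset.range c₁, x ^ (2 * d + 3)) +
          ∑ d ∈ Finset.range (L - c₁), x ^ (2 * d + 3)) :=
        mul_le_mul hii hi (nested7_form_nonneg u hx0 hx (hE c₁) (hE (L - c₂)) (hE' (L - c₂)))
          (nested7_form_nonneg w hx0 hx (hE c₂) (hE (L - d₁)) (hE' (L - d₁)))
    _ = _ := mul_comm _ _

end Summit.CriticalPhenomena.SAWScalingLimit.Theorems.BoundaryTP2
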